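import Mathlib
import Literature.NumberTheory.GaloisRepresentations.FrobeniusPlaces
import Summits.Langlands.Langlands.Theorems.PicardMuOrdinaryResidualAutomorphyEvenTeichmuller

/-!
# The cuspidality datum for a twist `θ` of `ε` congruent to `ε` modulo `𝔐`

Helper file for item stmt-Langlands-13760 (route `PicardMuOrdinary`, decl `ResidualAutomorphyEven`).
The cubic automorphic induction facts of the tree ask, for cuspidality of `AI_{E/K}(θ)`, for a place
`v` of `K` and two places `w ≠ w'` of `E` above `v` of the same residue degree, unramified for `θ`,
with `θ(ϖ_w) ≠ θ(ϖ_{w'})`.  The `Datum` file produces this for `θ = ε`; here we produce it for **every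
Hecke character `θ` of `E` whose normalised values `N w · θ(ϖ_w)` are algebraic integers congruent to
`ε(ϖ_w)` modulo a prime `𝔐 ∌ 2` of `ℤ̄`, at almost every `w`** (`exists_datum_of_congr`): at a good
place `v` with Frobenius the double transposition `(0 1)(2 3)` — of which there are infinitely many by
Frobenius' density theorem, so that any finite set of places can be avoided
(`exists_good_isArithFrobAt_d0_not_mem`) — the two degree-one places `w = placeOf 0`, `w' = placeOf 1`
have `ε(ϖ_w) = 1`, `ε(ϖ_{w'}) = -1`, whence `N v · θ(ϖ_w) ≡ 1` and `N v · θ(ϖ_{w'}) ≡ -1 (mod 𝔐)` and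
`θ(ϖ_w) ≠ θ(ϖ_{w'})` as `2 ∉ 𝔐`.  This is applied to `θ = ε ψ χ₀` (`ψ` algebraic of regular infinity
type, `χ₀` its Teichmüller twist).  Unconditional.
-/

set_option linter.dupNamespace false -- project-wide option (lakefile weak.linter.dupNamespace); `Summit.Langlands.Langlands` is the mandated namespace

noncomputable section

namespace Summit.Langlands.Langlands.Theorems.ResidualAutomorphyEven

open Polynomial Equiv Finset NumberField Pairing IsDedekindDomain Filter
open Literature.NumberTheory.GaloisRepresentations Literature.NumberTheory.Automorphic
  Literature.NumberTheory.LFunctions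
open scoped Classical Pointwise

variable {f : ℤ[X]} (h : IsSepQuartic f)

/-! ### Good places with Frobenius `(0 1)(2 3)` avoiding a finite set -/

/-- **There are good places `v` of `K` with Frobenius `d₀ = (0 1)(2 3)` outside any finite set `S`**
(Frobenius' density theorem gives infinitely many rational primes below such places). -/
theorem exists_good_isArithFrobAt_d0_not_mem (h12 : 12 ∣ Nat.card (G f)) (hlc : f.leadingCoeff ≠ 0)
    {S : Set (HeightOneSpectrum (𝓞 K))} (hS : S.Finite) :
    ∃ v : HeightOneSpectrum (𝓞 K), v ∉ badSet h ∧ v ∉ S ∧ ∃ W : Ideal (𝓞 (M f)), ∃ _ : W.IsMaximal,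
      v.asIdeal = W.under (𝓞 K) ∧ ∃ σ : G f, perm4 h σ = d0 ∧ IsArithFrobAt (𝓞 K) σ W := by
  haveI hG := isGalois_M h
  obtain ⟨σ, hσ⟩ := exists_perm4_eq h h12 d0 sign_d0
  -- Frobenius' theorem for the quadratic extension `M / M^{⟨σ⟩}`
  have hdens := hasStrongDirichletDensity_setOf_frobenius_generates (genFix σ) (mem_zpowers_genFix σ)
  have hc : 0 < ((Nat.totient (orderOf (genFix σ)) : ℝ) / orderOf (genFix σ)) := by
    have ho : 0 < orderOf (genFix σ) := orderOf_pos _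
    exact div_pos (Nat.cast_pos.mpr (Nat.totient_pos.mpr ho)) (Nat.cast_pos.mpr ho)
  have hinf := HasPrimeLogAsymp.infinite hdens hc
  -- discard the finitely many rational primes below the bad places of `K` and below `S`
  have hbadP : ((fun v : HeightOneSpectrum (𝓞 K) => Ideal.absNorm v.asIdeal) '' (badSet h ∪ S)).Finite :=
    ((finite_badSet h h12 hlc).union hS).image _
  have hfinP : {p : Nat.Primes | (p : ℕ) ∈ (fun v : HeightOneSpectrum (𝓞 K) => Ideal.absNorm v.asIdeal) '' (badSet h ∪ S)}.Finite :=
    hbadP.preimage Nat.Primes.coe_nat_injective.injOn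
  obtain ⟨p, hp, hpbad⟩ := (Set.Infinite.sdiff hinf hfinP).nonempty
  obtain ⟨q, ⟨-, hgen⟩, hqp⟩ := exists_mem_of_primeNormCount_ne_zero (Nat.cast_ne_zero.mp hp)
  -- a prime `W ∣ 𝔮` of `𝓞 M`; `σ` is a Frobenius over `K` there
  haveI := q.isMaximal
  obtain ⟨W, hWmax, hWq⟩ := Ideal.exists_maximal_ideal_liesOver_of_isIntegral (S := 𝓞 (M f)) q.asIdeal
  haveI := hWmax
  haveI := hWq
  obtain ⟨hfrob, hnorm⟩ := isArithFrobAt_sigma h hσ hG hgen p.2 hqp W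
  have hnormv : Ideal.absNorm ((placeW W).under (𝓞 K)).asIdeal = p := by
    rw [HeightOneSpectrum.under_asIdeal]; exact hnorm
  refine ⟨(placeW W).under (𝓞 K), fun hbad => hpbad ⟨_, Set.mem_union_left _ hbad, hnormv⟩,
    fun hmem => hpbad ⟨_, Set.mem_union_right _ hmem, hnormv⟩, W, hWmax, rfl, σ, hσ, hfrob⟩

/-! ### Values of `ε` -/

/-- `ε(ϖ_w)² = 1` at every place (`ε` is quadratic). -/
theorem valueAtUniformizer_eps_sq (h12 : 12 ∣ Nat.card (G f)) (hlc : f.leadingCoeff ≠ 0)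
    (w : HeightOneSpectrum (𝓞 (E h))) : ((eps h h12 hlc).valueAtUniformizer w) ^ 2 = 1 := by
  rw [HeckeCharacter.valueAtUniformizer, HeckeCharacter.localComponent_apply, eps, ← Units.val_pow_eq_pow_val,
    quadraticHeckeChar_apply_sq, Units.val_one]

/-- `ε(ϖ_w) = 1` or `ε(ϖ_w) = -1`. -/
theorem valueAtUniformizer_eps_eq_one_or (h12 : 12 ∣ Nat.card (G f)) (hlc : f.leadingCoeff ≠ 0)
    (w : HeightOneSpectrum (𝓞 (E h))) :
    (eps h h12 hlc).valueAtUniformizer w = 1 ∨ (eps h h12 hlc).valueAtUniformizer w = -1 :=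
  sq_eq_one_iff.mp (valueAtUniformizer_eps_sq h h12 hlc w)

/-- `ε(ϖ_w)` is an algebraic integer. -/
theorem isIntegral_valueAtUniformizer_eps (h12 : 12 ∣ Nat.card (G f)) (hlc : f.leadingCoeff ≠ 0)
    (w : HeightOneSpectrum (𝓞 (E h))) : IsIntegral ℤ ((eps h h12 hlc).valueAtUniformizer w) := by
  rcases valueAtUniformizer_eps_eq_one_or h h12 hlc w with h1 | h1 <;> rw [h1]
  · exact isIntegral_one
  · exact isIntegral_one.neg

/-- `zlift (-1) = -1`. -/
theorem zlift_neg_one : zlift (-1 : ℂ) = -1 := by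
  apply Subtype.val_injective
  change algebraMap (integralClosure ℤ ℂ) ℂ (zlift (-1)) = algebraMap (integralClosure ℤ ℂ) ℂ (-1)
  rw [map_neg, map_one, algebraMap_zlift isIntegral_one.neg]

/-! ### The datum -/

/-- **The cuspidality datum for a Hecke character congruent to `ε`.**  Let `𝔐` be an ideal of `ℤ̄` not
containing `2` and `θ` a Hecke character of `E` such that for almost every place `w` of `E`, `θ` is
unramified at `w` and `N w · θ(ϖ_w)` is an algebraic integer `≡ ε(ϖ_w) (mod 𝔐)`.  Then there are a
place `v` of `K` and places `w ≠ w'` of `E` above `v`, of the same residue degree, unramified for `θ`,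
with `θ(ϖ_w) ≠ θ(ϖ_{w'})`. -/
theorem exists_datum_of_congr (h12 : 12 ∣ Nat.card (G f)) (hlc : f.leadingCoeff ≠ 0)
    {𝔐 : Ideal (integralClosure ℤ ℂ)} (h2 : (2 : integralClosure ℤ ℂ) ∉ 𝔐) (θ : HeckeCharacter (E h))
    (hθ : ∀ᶠ w : HeightOneSpectrum (𝓞 (E h)) in cofinite, θ.IsUnramifiedAt w ∧
      ∃ z : integralClosure ℤ ℂ, algebraMap (integralClosure ℤ ℂ) ℂ z = (w.residueCard : ℂ) * θ.valueAtUniformizer w ∧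
        Ideal.Quotient.mk 𝔐 z = Ideal.Quotient.mk 𝔐 (zlift ((eps h h12 hlc).valueAtUniformizer w))) :
    ∃ (v : HeightOneSpectrum (𝓞 K)) (w w' : HeightOneSpectrum (𝓞 (E h))), w ≠ w' ∧
      w.under (𝓞 K) = v ∧ w'.under (𝓞 K) = v ∧
      w.asIdeal.inertiaDeg (𝓞 K) = w'.asIdeal.inertiaDeg (𝓞 K) ∧
      θ.IsUnramifiedAt w ∧ θ.IsUnramifiedAt w' ∧ θ.valueAtUniformizer w ≠ θ.valueAtUniformizer w' := by
  have hG := isGalois_M h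
  -- the finitely many bad places of `E` and their images in `K`
  set B : Set (HeightOneSpectrum (𝓞 (E h))) := {w | ¬ (θ.IsUnramifiedAt w ∧
      ∃ z : integralClosure ℤ ℂ, algebraMap (integralClosure ℤ ℂ) ℂ z = (w.residueCard : ℂ) * θ.valueAtUniformizer w ∧
        Ideal.Quotient.mk 𝔐 z = Ideal.Quotient.mk 𝔐 (zlift ((eps h h12 hlc).valueAtUniformizer w)))} with hB
  have hBfin : B.Finite := by rwa [Filter.eventually_cofinite] at hθ
  have hgood : ∀ w : HeightOneSpectrum (𝓞 (E h)), w ∉ B → θ.IsUnramifiedAt w ∧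
      ∃ z : integralClosure ℤ ℂ, algebraMap (integralClosure ℤ ℂ) ℂ z = (w.residueCard : ℂ) * θ.valueAtUniformizer w ∧
        Ideal.Quotient.mk 𝔐 z = Ideal.Quotient.mk 𝔐 (zlift ((eps h h12 hlc).valueAtUniformizer w)) := fun w hw => by
    by_contra hcon
    exact hw hcon
  set S : Set (HeightOneSpectrum (𝓞 K)) := (fun w : HeightOneSpectrum (𝓞 (E h)) => w.under (𝓞 K)) '' B with hS
  have hSfin : S.Finite := hBfin.image _
  -- a good place with Frobenius `d₀` outside `S`
  obtain ⟨v, hv, hvS, W, hWmax, hvW, σ, hσ, hfrob⟩ := exists_good_isArithFrobAt_d0_not_mem h h12 hlc hSfin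
  obtain ⟨hunr, h2W, -, -, hsW⟩ := good_of_not_mem_badSet h hv W hvW
  have hD := stabilizer_eq_zpowers W v hvW hG hunr hfrob
  set w := placeOf h h12 W v hvW 0 with hwdef
  set w' := placeOf h h12 W v hvW 1 with hw'def
  have hwv : w.under (𝓞 K) = v := placeOf_under _ _ _ _ _ _
  have hw'v : w'.under (𝓞 K) = v := placeOf_under _ _ _ _ _ _
  have hwB : w ∉ B := fun hmem => hvS ⟨w, hmem, hwv⟩
  have hw'B : w' ∉ B := fun hmem => hvS ⟨w', hmem, hw'v⟩
  obtain ⟨hunrw, z, hz, hzmod⟩ := hgood w hwB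
  obtain ⟨hunrw', z', hz', hz'mod⟩ := hgood w' hw'B
  -- residue degrees and the values of `ε`
  have hfw : w.asIdeal.inertiaDeg (𝓞 K) = 1 := by
    rw [hwdef, inertiaDeg_placeOf h h12 W v hvW hG hunr σ hD, hσ, period_d0.1]
  have hfw' : w'.asIdeal.inertiaDeg (𝓞 K) = 1 := by
    rw [hw'def, inertiaDeg_placeOf h h12 W v hvW hG hunr σ hD, hσ, period_d0.2]
  have hεw : (eps h h12 hlc).valueAtUniformizer w = 1 := by
    rw [hwdef, valueAtUniformizer_placeOf h h12 W v hvW hG hunr hlc hfrob 0 h2W hsW, hσ, blockSign_d0.1]; norm_num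
  have hεw' : (eps h h12 hlc).valueAtUniformizer w' = -1 := by
    rw [hw'def, valueAtUniformizer_placeOf h h12 W v hvW hG hunr hlc hfrob 1 h2W hsW, hσ, blockSign_d0.2]; norm_num
  have hNw : w.residueCard = v.residueCard := by
    rw [residueCard_eq_residueCard_pow_inertiaDeg (F := K) (w := w)
      (by rw [← HeightOneSpectrum.under_asIdeal, hwv]), hfw, pow_one]
  have hNw' : w'.residueCard = v.residueCard := by
    rw [residueCard_eq_residueCard_pow_inertiaDeg (F := K) (w := w')
      (by rw [← HeightOneSpectrum.under_asIdeal, hw'v]), hfw', pow_one]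
  refine ⟨v, w, w', ?_, hwv, hw'v, by rw [hfw, hfw'], hunrw, hunrw', fun heq => h2 ?_⟩
  · rw [Ne, hwdef, hw'def, placeOf_eq_placeOf_iff_mem_orbitFinset h h12 W v hvW hG hD, hσ]
    exact one_not_mem_orbitFinset_d0
  · -- `z = z'` in `ℤ̄`, but `z ≡ 1` and `z' ≡ -1 (mod 𝔐)`
    have hzz' : z = z' := by
      apply Subtype.val_injective
      change algebraMap (integralClosure ℤ ℂ) ℂ z = algebraMap (integralClosure ℤ ℂ) ℂ z'
      rw [hz, hz', hNw, hNw', heq]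
    rw [hεw, zlift_one, map_one] at hzmod
    rw [hεw', zlift_neg_one, map_neg, map_one] at hz'mod
    have h11 : (1 : integralClosure ℤ ℂ ⧸ 𝔐) = -1 :=
      calc (1 : integralClosure ℤ ℂ ⧸ 𝔐) = Ideal.Quotient.mk 𝔐 z := hzmod.symm
        _ = Ideal.Quotient.mk 𝔐 z' := by rw [hzz']
        _ = -1 := hz'mod
    have h11' : Ideal.Quotient.mk 𝔐 (1 : integralClosure ℤ ℂ) = Ideal.Quotient.mk 𝔐 (-1) := by
      rw [map_neg, map_one]; exact h11
    rw [Ideal.Quotient.eq] at h11'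
    have : (1 : integralClosure ℤ ℂ) - -1 = 2 := by norm_num
    rwa [this] at h11'

end Summit.Langlands.Langlands.Theorems.ResidualAutomorphyEven
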